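import Mathlib
import HarnessLib
import Summits.ValiantsHypothesis.ValiantsHypothesis.Theorems.MonotoneRestorationOrbitRestorationQPEigenFree

/-!
# Eigen-free transport: trivialising the unit cocycle of a family permuted up to units (SPAN currency; units → exact permutation, III)

Route MonotoneRestoration, crux `OrbitRestorationQP` (stmt-ValiantsHypothesis-18293), SPAN-currency lane of the open
sub-rung A_∞ (`stub_sigmaPiSigmaValue`), `ΠΣ` part.  Helper (`--supports`), def-free.  Sequel to `…EigenFree.lean`.

`NormalisedFactors.exists_rescaling_exactly_permuted_of_eigenFree` derives "permuted up to units" from unique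
factorisation, so it only applies to families of DEGREE-ONE factors.  The twisted residue of the `ΠΣ` sub-rung is
organised by BLOCKS (products of the factors with a common row/column support), which are permuted up to units along
the EXPLICIT action `(R, C) ↦ (σ R, τ C)` on supports but are not irreducible.  This file isolates the transport
argument from unique factorisation:

* **`exists_rescaling_of_eigenFree_transport`** — COCYCLE TRIVIALISATION: let `(L_i)_{i ∈ ι}` be nonzero polynomials,
  `κ σ τ : ι → ι` any maps, and suppose every renaming `(σ,τ)` carries `L_i` to a unit multiple of `L_{κ σ τ i}`
  ("permuted up to units along `κ`") and no renaming rescales any `L_i` non-trivially (EIGEN-FREE).  Then there are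
  nonzero constants `d_i` with `(σ,τ) · (d_i L_i) = d_{κ σ τ i} L_{κ σ τ i}` EXACTLY, for all `σ, τ, i`.  (No finiteness,
  no degree hypothesis; `κ` need not be a permutation.)  Construction as in `…EigenFree.lean`: `d_i L_i` is THE
  translate on the line of `L_i` of a canonically chosen member of its line-orbit (`translate_scalar_unique`).

Lane note: with the block transport lemma (blocks of a matrix-symmetric affine product are permuted up to units along
the support action) and `CorePatterns.prod_mem_narrowSpan_of_stable_localPolyFactors` (`…StableLocalPolyFactors.lean`),
this is the normalisation step of the BLOCK-UNTWISTED case of the twisted residue.  No registered stub is closed; the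
crux and VP ≠ VNP are not moved. [folklore]
-/

noncomputable section

-- `Summit.ValiantsHypothesis.ValiantsHypothesis.…` is the tree's single-conjunct layout (Sub = Summit).
set_option linter.dupNamespace false

namespace Summit.ValiantsHypothesis.ValiantsHypothesis.Theorems

namespace NormalisedFactors

open MvPolynomial Finset Equiv ProductAction

variable {n : ℕ}

/-- **COCYCLE TRIVIALISATION (eigen-free transport).**  If every row/column renaming carries each `L_i ≠ 0` to a unit
multiple of `L_{κ σ τ i}` and the family is eigen-free, then after rescaling by nonzero constants the renamings carry
`d_i L_i` to `d_{κ σ τ i} L_{κ σ τ i}` exactly. [folklore] -/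
theorem exists_rescaling_of_eigenFree_transport {ι : Type} (L : ι → MvPolynomial (Fin n × Fin n) ℂ)
    (hL0 : ∀ i, L i ≠ 0) (κ : Perm (Fin n) → Perm (Fin n) → ι → ι)
    (hassoc : ∀ (σ τ : Perm (Fin n)) (i : ι), ∃ c : ℂ, c ≠ 0 ∧
      rename (fun P : Fin n × Fin n => (σ P.1, τ P.2)) (L i) = C c * L (κ σ τ i))
    (heigen : ∀ (σ τ : Perm (Fin n)) (i : ι) (c : ℂ),
      rename (fun P : Fin n × Fin n => (σ P.1, τ P.2)) (L i) = C c * L i → c = 1) :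
    ∃ d : ι → ℂ, (∀ i, d i ≠ 0) ∧ ∀ (σ τ : Perm (Fin n)) (i : ι),
      rename (fun P : Fin n × Fin n => (σ P.1, τ P.2)) (C (d i) * L i) = C (d (κ σ τ i)) * L (κ σ τ i) := by
  classical
  -- the line-orbit relation `Q i j`: some translate of `L j` lies on the line of `L i`
  set Q : ι → ι → Prop := fun i j => ∃ (σ τ : Perm (Fin n)) (c : ℂ), c ≠ 0 ∧
    rename (fun P : Fin n × Fin n => (σ P.1, τ P.2)) (L j) = C c * L i with hQ
  have hQrefl : ∀ i, Q i i := fun i => ⟨1, 1, 1, one_ne_zero, by rw [rename_rowCol_one, C_1, one_mul]⟩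
  have hQtrans : ∀ (i i' : ι) (σ τ : Perm (Fin n)) (c : ℂ), c ≠ 0 →
      rename (fun P : Fin n × Fin n => (σ P.1, τ P.2)) (L i) = C c * L i' → Q i = Q i' := by
    intro i i' σ τ c hc h
    funext j
    apply propext
    constructor
    · rintro ⟨σ₁, τ₁, c₁, hc₁, h₁⟩
      refine ⟨σ * σ₁, τ * τ₁, c₁ * c, mul_ne_zero hc₁ hc, ?_⟩
      rw [← rename_rowCol_mul, h₁, map_mul, rename_C, h, ← mul_assoc, ← map_mul]
    · rintro ⟨σ₁, τ₁, c₁, hc₁, h₁⟩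
      refine ⟨σ⁻¹ * σ₁, τ⁻¹ * τ₁, c₁ * c⁻¹, mul_ne_zero hc₁ (inv_ne_zero hc), ?_⟩
      have hi : rename (fun P : Fin n × Fin n => (σ⁻¹ P.1, τ⁻¹ P.2)) (L i') = C c⁻¹ * L i := by
        have h2 := congrArg (rename (fun P : Fin n × Fin n => (σ⁻¹ P.1, τ⁻¹ P.2))) h
        rw [rename_rowCol_inv, map_mul, rename_C] at h2
        have h3 := congrArg (fun q => C c⁻¹ * q) h2
        rw [← mul_assoc, ← map_mul, inv_mul_cancel₀ hc, C_1, one_mul] at h3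
        exact h3.symm
      rw [← rename_rowCol_mul, h₁, map_mul, rename_C, hi, ← mul_assoc, ← map_mul]
  -- canonical member of a line-orbit
  have hne : ∀ i, ∃ j, Q i j := fun i => ⟨i, hQrefl i⟩
  have hchoose : ∀ (P P' : ι → Prop) (hP : ∃ j, P j) (hP' : ∃ j, P' j), P = P' →
      Classical.choose hP = Classical.choose hP' := by
    rintro P P' hP hP' rfl
    rfl
  set jstar : ι → ι := fun i => Classical.choose (hne i) with hjstar
  have hjQ : ∀ i, Q i (jstar i) := fun i => Classical.choose_spec (hne i)
  have hjeq : ∀ i i', Q i = Q i' → jstar i = jstar i' := fun i i' h => hchoose (Q i) (Q i') (hne i) (hne i') h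
  -- the rescaling: `d i · L i` is THE translate of `L (jstar i)` on the line of `L i`
  have hdata : ∀ i, ∃ c : ℂ, c ≠ 0 ∧ ∃ σ τ : Perm (Fin n),
      rename (fun P : Fin n × Fin n => (σ P.1, τ P.2)) (L (jstar i)) = C c * L i := by
    intro i
    obtain ⟨σ, τ, c, hc, h⟩ := hjQ i
    exact ⟨c, hc, σ, τ, h⟩
  choose d hd0 hdst using hdata
  refine ⟨d, hd0, fun σ τ i => ?_⟩
  obtain ⟨c₁, hc₁, h1⟩ := hassoc σ τ i
  have hj : jstar i = jstar (κ σ τ i) := hjeq i (κ σ τ i) (hQtrans i (κ σ τ i) σ τ c₁ hc₁ h1)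
  obtain ⟨σ₁, τ₁, hg⟩ := hdst i
  obtain ⟨σ₂, τ₂, hg'⟩ := hdst (κ σ τ i)
  rw [← hj] at hg'
  have ht1 : rename (fun P : Fin n × Fin n => ((σ * σ₁) P.1, (τ * τ₁) P.2)) (L (jstar i)) =
      C (d i * c₁) * L (κ σ τ i) := by
    rw [← rename_rowCol_mul, hg, map_mul, rename_C, h1, ← mul_assoc, ← map_mul]
  have heq := translate_scalar_unique L hL0 heigen ht1 hg'
  rw [map_mul, rename_C, h1, ← mul_assoc, ← map_mul, heq]

/-- **Exact transport gives an exactly permuted family when `κ σ τ` are bijections** (the finite, permutation form used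
by `CorePatterns.prod_mem_narrowSpan_of_stable_localPolyFactors`). [folklore] -/
theorem exists_rescaling_exactly_permuted_of_eigenFree_transport {ι : Type} (L : ι → MvPolynomial (Fin n × Fin n) ℂ)
    (hL0 : ∀ i, L i ≠ 0) (κ : Perm (Fin n) → Perm (Fin n) → Perm ι)
    (hassoc : ∀ (σ τ : Perm (Fin n)) (i : ι), ∃ c : ℂ, c ≠ 0 ∧
      rename (fun P : Fin n × Fin n => (σ P.1, τ P.2)) (L i) = C c * L (κ σ τ i))
    (heigen : ∀ (σ τ : Perm (Fin n)) (i : ι) (c : ℂ),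
      rename (fun P : Fin n × Fin n => (σ P.1, τ P.2)) (L i) = C c * L i → c = 1) :
    ∃ d : ι → ℂ, (∀ i, d i ≠ 0) ∧ ∀ σ τ : Perm (Fin n), ∃ κ' : Perm ι, ∀ i,
      rename (fun P : Fin n × Fin n => (σ P.1, τ P.2)) (C (d i) * L i) = C (d (κ' i)) * L (κ' i) := by
  obtain ⟨d, hd0, h⟩ := exists_rescaling_of_eigenFree_transport L hL0 (fun σ τ i => κ σ τ i) hassoc heigen
  exact ⟨d, hd0, fun σ τ => ⟨κ σ τ, fun i => h σ τ i⟩⟩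

end NormalisedFactors

end Summit.ValiantsHypothesis.ValiantsHypothesis.Theorems

end
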